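import Literature.AlgebraicGeometry.AbelianSchemes.LevelStructureSymplecticClassLocus
import Literature.AlgebraicGeometry.AbelianSchemes.SymplecticLiftableOfOnePoint
import Literature.AlgebraicGeometry.Morphisms.LocallyNoetherianLocallyConnected
import HarnessLib

/-!
# The symplectic-liftable locus of a level structure is open and closed
# ([Lan2013PELCompactifications] Lemma 1.3.6.6 / Cor. 1.3.6.7; the F-6 (V′) symplectic socket)

Layer `Literature/AlgebraicGeometry/AbelianSchemes`, namespace `Literature.AlgebraicGeometry.AbelianSchemes.AbelianSchemeOver`.
THEOREMS ONLY (no definition, no named fact, no instance, no notation, no `sorry`).  Cell `hodgecm-mathlib` (D-0151),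
F-DAG F-10 (b) step (b4) «the cover» / F-6 (V′) second socket, FILE B of the pair announced with ★
`LevelStructureSymplecticClassLocus` (FILE A; author B-p02 (g13), sub-hand under B-p06 (g11)'s (b) lead): the symplectic twin
of ★ `PolarizationTypeLocus`.  Count-neutral capital; HC_CM is proved only modulo the 7 printed citations until rung 0 closes —
nothing here is about HC.

[Lan2013PELCompactifications] Lemma 1.3.6.6 (pp. 81–82): over a connected locally noetherian base, «`α_n` is symplectic-liftable
… if and only if it is symplectic-liftable at every geometric point `s̄`» — equivalently at ONE geometric point; Cor. 1.3.6.7: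
over a general locally noetherian base, one geometric point per connected component.  Hence the set of points of the base
over which the POINTWISE CLAUSE of FILE A

  `Lift(x)` :≡ `∀ Ω (s : Spec Ω → S) over x, ∀ Θ ample with λ̄_s = Λ(𝒪(Θ)), Nonempty (φ.SymplecticLift s Θ δ)`

holds is a union of connected components: OPEN AND CLOSED.  The one-point-to-connected-base step is ★
`LevelStructure.isSymplecticLiftable_of_nonempty_symplecticLift` ((h9-S) W3c, B-p13 (g19) / B-p11 (g16)); this file is the
componentwise packaging and the passage to the reduced base.

* §1 `nonempty_symplecticLift_of_mem_connectedComponent` — ONE lift at ONE geometric point over `x` gives `Lift(y)` at every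
  `y` in the connected component of `x` (locally Noetherian base in which every positive integer is invertible, NOT assumed
  reduced — the W3c head used is the reducedness-free ★ `isSymplecticLiftable_of_nonempty_symplecticLift_of_isLocallyNoetherian`):
  the component is an open subscheme `U`, the W3c head applies to `φ ×_S U`, and FILE A moves the clause up and down `U ↪ S`;
  `liftAt_of_nonempty_symplecticLift` — the case `y = x` (in particular `Lift(x)` does not depend on the chosen geometric
  point, field or witness) = the pointwise criterion the (b4) cover reads;
* §2 **`isClopen_setOf_liftAt`** — `{x | Lift(x)}` is open and closed over any locally Noetherian base with every positive
  integer invertible in its residue fields (the form the consumers cite: F-6's `H₄` and F-10 (b4)'s cover of level-`NK` bases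
  are not reduced).

## References
* [Lan2013PELCompactifications] K.-W. Lan, *Arithmetic compactifications of PEL-type Shimura varieties*, LMS Monographs 36
  (2013), §1.3.6 Def. 1.3.6.2 (p. 80), Lemma 1.3.6.5 (p. 81), Lemma 1.3.6.6 and Cor. 1.3.6.7 (pp. 81–82).
* [MumfordFogartyKirwan1994] D. Mumford, J. Fogarty, F. Kirwan, *Geometric Invariant Theory*, 3rd ed. (1994), App. 7A
  (pp. 234–235): `𝒜_{g,d,n}` is the disjoint union of open and closed subschemes.
* Tree: ★ `LevelStructureSymplecticClassLocus` (FILE A), ★ `SymplecticLiftableOfOnePoint` (W3c heads), ★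
  `Morphisms.LocallyNoetherianLocallyConnected`.
-/

noncomputable section

universe u

open CategoryTheory CategoryTheory.Limits AlgebraicGeometry

namespace Literature.AlgebraicGeometry.AbelianSchemes

namespace AbelianSchemeOver

open Literature.AlgebraicGeometry.Motives Literature.AlgebraicGeometry.Morphisms
open scoped MonObj

variable {S : Scheme.{u}} (A : AbelianSchemeOver S) {D : A.DualPair} (pol : A.Polarization D) {g₀ N : ℕ}
  (φ : A.LevelStructure g₀ N) (δ : Fin g₀ → ℕ)

/-! ### §0 Plumbing: geometric points and open / closed subschemes -/

/-- A geometric point whose image lies in an open `U ⊆ S` factors through the open subscheme `U`. [folklore] -/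
private theorem exists_lift_of_mem_opens' (U : S.Opens) {Ω : Type u} [Field Ω] (s : Spec (.of Ω) ⟶ S)
    (hs : s.base (IsLocalRing.closedPoint Ω) ∈ U) : ∃ s' : Spec (.of Ω) ⟶ (U : Scheme.{u}), s' ≫ U.ι = s := by
  have hr : Set.range s.base ⊆ Set.range U.ι.base := by
    rintro _ ⟨p, rfl⟩
    rw [Scheme.Opens.range_ι, Subsingleton.elim p (IsLocalRing.closedPoint Ω)]
    exact hs
  exact ⟨IsOpenImmersion.lift U.ι s hr, IsOpenImmersion.lift_fac U.ι s hr⟩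

/-- Every positive integer stays invertible in the residue fields along a morphism `f : S′ → S` (residue fields map
injectively). [folklore] -/
private theorem forall_natCast_residueField_ne_zero_of_hom {S' : Scheme.{u}} (f : S' ⟶ S)
    (hQ : ∀ M : ℕ, M ≠ 0 → ∀ s : S, (M : S.residueField s) ≠ 0) :
    ∀ M : ℕ, M ≠ 0 → ∀ s' : S', (M : S'.residueField s') ≠ 0 := fun M hM s' => by
  have h := (map_ne_zero (f.residueFieldMap s').hom).mpr (hQ M hM (f.base s'))
  rwa [map_natCast] at h

/-! ### §1 One lift at one geometric point spreads over the connected component -/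

/-- **ONE SYMPLECTIC LIFT AT ONE GEOMETRIC POINT OVER `x` GIVES THE CLAUSE `Lift(y)` AT EVERY `y` IN THE CONNECTED COMPONENT
OF `x`** (locally Noetherian base `S` with every positive integer invertible in its residue fields, `N ≠ 0`, relative
dimension `g`; no reducedness).  The connected component is an OPEN subscheme `U` (★ `locallyConnectedSpace_of_isLocallyNoetherian`),
preconnected and locally Noetherian; the lift moves to `φ ×_S U` at the lifted point (★ FILE A
`SymplecticLift.nonempty_baseChange`, ★ `IsLambdaOfAt.baseChange`); the reducedness-free W3c head ★
`isSymplecticLiftable_of_nonempty_symplecticLift_of_isLocallyNoetherian` makes `φ ×_S U` symplectic-liftable; and the clause comes back down at the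
geometric points over `y ∈ U` (★ FILE A `nonempty_symplecticLift_of_forall_baseChange`).
[cite: Lan2013PELCompactifications, §1.3.6 Lemma 1.3.6.6 and Cor. 1.3.6.7 (pp. 81–82)] -/
theorem LevelStructure.nonempty_symplecticLift_of_mem_connectedComponent [IsLocallyNoetherian S]
    (hg : A.IsOfRelDim g₀) (hQ : ∀ M : ℕ, M ≠ 0 → ∀ s : S, (M : S.residueField s) ≠ 0) (hN : N ≠ 0)
    {x y : S} (hy : y ∈ connectedComponent x)
    {Ω₀ : Type u} [Field Ω₀] [IsAlgClosed Ω₀] (s₀ : Spec (.of Ω₀) ⟶ S) (hs₀ : s₀.base (IsLocalRing.closedPoint Ω₀) = x)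
    {Θ₀ : CartierDivisor (A.fibre s₀).toAbelianVariety.X.left} (hlam₀ : A.IsLambdaOfAt s₀ D pol.lam Θ₀)
    (Λ₀ : φ.SymplecticLift s₀ Θ₀ δ)
    {Ω : Type u} [Field Ω] [IsAlgClosed Ω] (t : Spec (.of Ω) ⟶ S) (ht : t.base (IsLocalRing.closedPoint Ω) = y)
    {Θ : CartierDivisor (A.fibre t).toAbelianVariety.X.left} (hΘ : Θ.IsAmple) (hlam : A.IsLambdaOfAt t D pol.lam Θ) :
    Nonempty (φ.SymplecticLift t Θ δ) := by
  haveI := locallyConnectedSpace_of_isLocallyNoetherian S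
  -- the connected component as an open subscheme
  let U : S.Opens := ⟨connectedComponent x, isOpen_connectedComponent⟩
  haveI : PreconnectedSpace (U : Scheme.{u}) :=
    Subtype.preconnectedSpace (isPreconnected_connectedComponent (x := x))
  have hQU := forall_natCast_residueField_ne_zero_of_hom U.ι hQ
  -- the lift moved to `φ ×_S U` at the lifted point over `x`
  obtain ⟨s₀', rfl⟩ := exists_lift_of_mem_opens' U s₀ (by rw [hs₀]; exact mem_connectedComponent)
  obtain ⟨Λ₀'⟩ := LevelStructure.SymplecticLift.nonempty_baseChange A U.ι φ δ s₀' Λ₀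
  have hU : (φ.baseChange U.ι).IsSymplecticLiftable (pol.baseChange U.ι) δ :=
    LevelStructure.isSymplecticLiftable_of_nonempty_symplecticLift_of_isLocallyNoetherian (hg.baseChange U.ι) hQU
      (φ.baseChange U.ι) hN
      (pol.baseChange U.ι) δ s₀' (A.divisorBaseChange U.ι s₀' Θ₀) (IsLambdaOfAt.baseChange A U.ι D s₀' pol.lam Θ₀ hlam₀)
      Λ₀'
  -- back down at the geometric points over `y`
  obtain ⟨t', rfl⟩ := exists_lift_of_mem_opens' U t (by rw [ht]; exact hy)
  exact LevelStructure.nonempty_symplecticLift_of_forall_baseChange A U.ι pol φ δ t'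
    (fun Θ' hΘ' hlam' => hU Ω t' Θ' hΘ' hlam') hΘ hlam

/-- **ONE LIFT OVER `x` GIVES `Lift(x)`**: the clause at `x` does not depend on the geometric point over `x`, the
algebraically closed field, or the (ample) witness — the case `y = x` of the spreading. [cite: Lan2013PELCompactifications, §1.3.6 Lemma 1.3.6.6 and Cor. 1.3.6.7 (pp. 81–82)] -/
theorem LevelStructure.liftAt_of_nonempty_symplecticLift [IsLocallyNoetherian S]
    (hg : A.IsOfRelDim g₀) (hQ : ∀ M : ℕ, M ≠ 0 → ∀ s : S, (M : S.residueField s) ≠ 0) (hN : N ≠ 0) {x : S}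
    {Ω₀ : Type u} [Field Ω₀] [IsAlgClosed Ω₀] (s₀ : Spec (.of Ω₀) ⟶ S) (hs₀ : s₀.base (IsLocalRing.closedPoint Ω₀) = x)
    {Θ₀ : CartierDivisor (A.fibre s₀).toAbelianVariety.X.left} (hlam₀ : A.IsLambdaOfAt s₀ D pol.lam Θ₀)
    (Λ₀ : φ.SymplecticLift s₀ Θ₀ δ) :
    ∀ (Ω : Type u) [Field Ω] [IsAlgClosed Ω] (s : Spec (.of Ω) ⟶ S), s.base (IsLocalRing.closedPoint Ω) = x →
      ∀ Θ : CartierDivisor (A.fibre s).toAbelianVariety.X.left, Θ.IsAmple → A.IsLambdaOfAt s D pol.lam Θ →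
        Nonempty (φ.SymplecticLift s Θ δ) :=
  fun _ _ _ s hs _ hΘ hlam =>
    LevelStructure.nonempty_symplecticLift_of_mem_connectedComponent A pol φ δ hg hQ hN mem_connectedComponent s₀ hs₀
      hlam₀ Λ₀ s hs hΘ hlam

/-! ### §2 The liftable locus is open and closed -/

/-- **THE SYMPLECTIC-LIFTABLE LOCUS IS OPEN AND CLOSED** over a locally Noetherian base with every positive integer
invertible in its residue fields — no reducedness ([Lan2013PELCompactifications] Cor. 1.3.6.7; [MumfordFogartyKirwan1994] App. 7A):
the set of points `x` with `Lift(x)` is saturated for connected components (§1, with a geometric point over `x` and an ample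
witness from ★ `Polarization.exists_ample`), hence a union of the open connected components, hence clopen.
[cite: Lan2013PELCompactifications, §1.3.6 Lemma 1.3.6.6 and Cor. 1.3.6.7 (pp. 81–82)]
[cite: MumfordFogartyKirwan1994, App. 7A (pp. 234–235)] -/
theorem LevelStructure.isClopen_setOf_liftAt [IsLocallyNoetherian S] (hg : A.IsOfRelDim g₀)
    (hQ : ∀ M : ℕ, M ≠ 0 → ∀ s : S, (M : S.residueField s) ≠ 0) (hN : N ≠ 0) :
    IsClopen {x : S | ∀ (Ω : Type u) [Field Ω] [IsAlgClosed Ω] (s : Spec (.of Ω) ⟶ S),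
      s.base (IsLocalRing.closedPoint Ω) = x →
      ∀ Θ : CartierDivisor (A.fibre s).toAbelianVariety.X.left, Θ.IsAmple → A.IsLambdaOfAt s D pol.lam Θ →
        Nonempty (φ.SymplecticLift s Θ δ)} := by
  haveI := locallyConnectedSpace_of_isLocallyNoetherian S
  -- one direction of saturation: `Lift(x)` and `y ∈ component(x)` give `Lift(y)`
  have hsat : ∀ x y : S, y ∈ connectedComponent x →
      (∀ (Ω : Type u) [Field Ω] [IsAlgClosed Ω] (s : Spec (.of Ω) ⟶ S), s.base (IsLocalRing.closedPoint Ω) = x →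
        ∀ Θ : CartierDivisor (A.fibre s).toAbelianVariety.X.left, Θ.IsAmple → A.IsLambdaOfAt s D pol.lam Θ →
          Nonempty (φ.SymplecticLift s Θ δ)) →
      ∀ (Ω : Type u) [Field Ω] [IsAlgClosed Ω] (s : Spec (.of Ω) ⟶ S), s.base (IsLocalRing.closedPoint Ω) = y →
        ∀ Θ : CartierDivisor (A.fibre s).toAbelianVariety.X.left, Θ.IsAmple → A.IsLambdaOfAt s D pol.lam Θ →
          Nonempty (φ.SymplecticLift s Θ δ) := by
    intro x y hy hx Ω _ _ t ht Θ hΘ hlam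
    -- a geometric point over `x` with an ample witness, where `Lift(x)` supplies a lift
    let Ω₀ : Type u := AlgebraicClosure (S.residueField x)
    let s₀ : Spec (.of Ω₀) ⟶ S :=
      Spec.map (CommRingCat.ofHom (algebraMap (S.residueField x) Ω₀)) ≫ S.fromSpecResidueField x
    have hs₀ : s₀.base (IsLocalRing.closedPoint Ω₀) = x := by
      change (S.fromSpecResidueField x).base _ = x
      exact Scheme.fromSpecResidueField_apply x _
    obtain ⟨Θ₀, hΘ₀, hlam₀⟩ := pol.exists_ample Ω₀ s₀
    obtain ⟨Λ₀⟩ := hx Ω₀ s₀ hs₀ Θ₀ hΘ₀ hlam₀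
    exact LevelStructure.nonempty_symplecticLift_of_mem_connectedComponent A pol φ δ hg hQ hN hy s₀ hs₀ hlam₀ Λ₀ t ht
      hΘ hlam
  constructor
  · -- closed: the complement is a union of (open) connected components
    rw [← isOpen_compl_iff, isOpen_iff_mem_nhds]
    intro x hx
    exact Filter.mem_of_superset (isOpen_connectedComponent.mem_nhds mem_connectedComponent)
      fun y hy hy' => hx (hsat y x (connectedComponent_eq hy ▸ mem_connectedComponent) hy')
  · -- open: a union of (open) connected components
    rw [isOpen_iff_mem_nhds]
    intro x hx
    exact Filter.mem_of_superset (isOpen_connectedComponent.mem_nhds mem_connectedComponent)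
      fun y hy => hsat x y hy hx

end AbelianSchemeOver

end Literature.AlgebraicGeometry.AbelianSchemes

end
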